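import Summits.QuantumFields.YangMills.Theorems.FluctuationComparisonRegPrIntLS2BetaTubeLettersOrbitTransport
import Summits.QuantumFields.YangMills.Theorems.FluctuationComparisonRegPrIntLS2BetaFlatGapOutright
import HarnessLib

/-!
# (RG-K) ORBIT TRANSPORT of the (T)-chain's letters, II — POS∘ ∕ ISOL∘ are EQUIVARIANT; TUBE♭ ∕ GAP♭ OUTRIGHT AT EVERY PURE-GAUGE DATUM `(v•1, v̂•1)`

Sequel of ✓`…S2BetaTubeLettersOrbitTransport` (§1–§3 there: the descent-preserving group is normalised by every fine `u`, the sup-tube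
clause and the orbit functional `𝒟(U;U₀)` are invariant under `(U,U₀) ↦ (u•U, u•U₀)`, the (closed) good fibre over `V` is carried onto the
one over `u↓•V`, TUBE♭ ∕ GAP♭ are equivariant).  Helper for crux `stmt-QuantumFields-20520` (`Theses.UnitScaleTilt.FluctuationComparisonRegPrIntL`),
the (T)-chain of LINE `semiclassical_s2beta` (cell `ym3-torus`, width seat «width 16» px16 g18).

* §1 ★ `posCollarAt_gaugeAct_iff` — POS∘ (px8's `hpos` collar letter of ✓`tubeGrowth_of_pos_of_isolated`) at `(u↓•V, u•U₀)` ⟺ at `(V, U₀)`;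
  ★ `isolAt_gaugeAct_iff` — ISOL∘(δ) (the `hisol` binder of (T3)) likewise.
* §2 THE ORBIT-LEVEL FLAT INHABITANT.  ✓px12 g21 `…S2BetaFlatGapOutright.exists_tubeGrowth_flat ∕ exists_gapFlat_flat` (TUBE♭(1,1) ∕ GAP♭(1,1)
  with NO letter; over ✓px16 g17 bricks 1–5, ✓`Prop7FlatDatum`, ✓`exists_gamma_closedGoodFibre`) transported along the gauge orbit of the flat
  datum: ★★★ `exists_tubeGrowth_pureGauge` ∕ ★★★ `exists_gapFlat_pureGauge` — TUBE♭ ∕ GAP♭ OUTRIGHT at EVERY PURE-GAUGE DATUM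
  `(V, U₀) = (v•1, v̂•1)`, `v` ANY coarse gauge transformation, `v̂ := liftTransfTo v` (✓`descTransf_liftTransfTo`), with the SAME `γ₁, μ` as at
  `(1,1)`; and the conditional edition ★★ `exists_gapFlat_pureGauge_of_isolated` over ✓brick 5 §1 (GAP♭ there ⟸ ISOL∘(δ) there).

HONEST: finite-group ∕ topology bookkeeping over landed letters; nothing of Bałaban's analysis; pure-gauge data only (the orbit of the flat
datum); this file proves NO stub of the line — TUBE-REG∘ (K-uniform `μ`, universal `δ`), GAP♯∘, EXW∘, S2β and crux 20520 stay OPEN; rung R3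
(YM₃ on T³) is NOT d = 4, NOT infinite volume, NOT a mass gap, NOT Clay; the Yang–Mills mass gap is NOT proved.
-/

set_option autoImplicit false

noncomputable section

open Set Filter Topology Function
open scoped Matrix.Norms.L2Operator
open Literature.MathematicalPhysics.QuantumFieldTheory.Balaban1983to89
open Literature.MathematicalPhysics.QuantumFieldTheory.Balaban1983to89.T3ContinuumYM3Torus
open Literature.MathematicalPhysics.QuantumFieldTheory.Balaban1983to89.T3UnitLawDensityEML (ℰp)
open Literature.MathematicalPhysics.QuantumFieldTheory.Balaban1983to89.T3UnitScaleTilt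
open Literature.MathematicalPhysics.QuantumFieldTheory.Balaban1983to89.T3TiltDescent
open Literature.MathematicalPhysics.QuantumFieldTheory.Balaban1983to89.T3ConstrainedMinimiser (fibre)
open Literature.MathematicalPhysics.QuantumFieldTheory.Balaban1983to89.T3PrintedRegularMinimiser
open Literature.MathematicalPhysics.QuantumFieldTheory.Balaban1983to89.T3PrintedRegularOrbits
open scoped Literature.MathematicalPhysics.QuantumFieldTheory.Balaban1983to89.T3OrbitAverage
open Literature.MathematicalPhysics.QuantumFieldTheory.Balaban1983to89.ExpMeanLog (deltaSU)
open Summit.QuantumFields.YangMills.Theorems.FluctuationComparisonRegPrIntLS2BetaResidualGauge (gaugeAct_mem_histGood_iff wilsonAction4_gaugeAct)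
open Summit.QuantumFields.YangMills.Theorems.FluctuationComparisonRegPrIntLS2BetaFlatGapOfIsolated (exists_gapFlat_flat_of_isolated)
open Summit.QuantumFields.YangMills.Theorems.FluctuationComparisonRegPrIntLS2BetaFlatGapOutright (exists_tubeGrowth_flat exists_gapFlat_flat)
open Summit.QuantumFields.YangMills.Theorems.FluctuationComparisonRegPrIntLS2BetaTubeRegularSmall (gaugeAct_gaugeAct_inv)
open Summit.QuantumFields.YangMills.Theorems.FluctuationComparisonRegPrIntLS2BetaTubeLettersOrbitTransport

namespace Summit.QuantumFields.YangMills.Theorems.FluctuationComparisonRegPrIntLS2BetaTubeLettersOrbitTransportOutright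

variable (F : T3Family) {J K : ℕ} (hJK : J ≤ K)

/-! ## §1 POS∘ and ISOL∘ are equivariant -/

/-- ★ **POS∘ IS EQUIVARIANT** (px8's `hpos` collar letter of ✓`tubeGrowth_of_pos_of_isolated`, radius `δ`, collar `r`, constant `c`).
[cite: Balaban1985Variational, (142) p.299; Balaban1985UV3, (12)-(13) p.259] -/
theorem posCollarAt_gaugeAct_iff (u : Site (F.P K) 0 → Matrix.specialUnitaryGroup (Fin 2) ℂ) {γ b₀ p₀ ε₀ : ℝ} (hε₀ : 0 ≤ ε₀)
    (V : GaugeField (F.P J) 0 (Matrix.specialUnitaryGroup (Fin 2) ℂ)) (U₀ : GaugeField (F.P K) 0 (Matrix.specialUnitaryGroup (Fin 2) ℂ))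
    (δ r c : ℝ) :
    (∀ U ∈ closure (fibre F ℰp J K hJK (GaugeField.gaugeAct (descTransf F J K hJK u) V) ∩ histGood F ℰp (θBal F.L γ b₀ p₀) K J),
      (∃ w : Site (F.P K) 0 → Matrix.specialUnitaryGroup (Fin 2) ℂ,
        (∀ U'' : GaugeField (F.P K) 0 (Matrix.specialUnitaryGroup (Fin 2) ℂ),
            descendTo F ℰp J K hJK (GaugeField.gaugeAct w U'') = descendTo F ℰp J K hJK U'') ∧
          ∀ ℓ : PBond (F.P K) 0, dist1 (U ℓ * ((GaugeField.gaugeAct w (GaugeField.gaugeAct u U₀)) ℓ)⁻¹) ≤ δ) →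
      (⨅ w : {w : Site (F.P K) 0 → Matrix.specialUnitaryGroup (Fin 2) ℂ |
          ∀ U : GaugeField (F.P K) 0 (Matrix.specialUnitaryGroup (Fin 2) ℂ),
            descendTo F ℰp J K hJK (GaugeField.gaugeAct w U) = descendTo F ℰp J K hJK U},
        ∑ ℓ : PBond (F.P K) 0,
          dist1 (U ℓ * ((GaugeField.gaugeAct (w : Site (F.P K) 0 → Matrix.specialUnitaryGroup (Fin 2) ℂ) (GaugeField.gaugeAct u U₀)) ℓ)⁻¹) ^ 2) ≤ r →
      c * (⨅ w : {w : Site (F.P K) 0 → Matrix.specialUnitaryGroup (Fin 2) ℂ |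
          ∀ U : GaugeField (F.P K) 0 (Matrix.specialUnitaryGroup (Fin 2) ℂ),
            descendTo F ℰp J K hJK (GaugeField.gaugeAct w U) = descendTo F ℰp J K hJK U},
        ∑ ℓ : PBond (F.P K) 0,
          dist1 (U ℓ * ((GaugeField.gaugeAct (w : Site (F.P K) 0 → Matrix.specialUnitaryGroup (Fin 2) ℂ) (GaugeField.gaugeAct u U₀)) ℓ)⁻¹) ^ 2)
        ≤ wilsonAction4 U - minActionRegPr F J K hJK ε₀ (GaugeField.gaugeAct (descTransf F J K hJK u) V)) ↔
    (∀ U ∈ closure (fibre F ℰp J K hJK V ∩ histGood F ℰp (θBal F.L γ b₀ p₀) K J),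
      (∃ w : Site (F.P K) 0 → Matrix.specialUnitaryGroup (Fin 2) ℂ,
        (∀ U'' : GaugeField (F.P K) 0 (Matrix.specialUnitaryGroup (Fin 2) ℂ),
            descendTo F ℰp J K hJK (GaugeField.gaugeAct w U'') = descendTo F ℰp J K hJK U'') ∧
          ∀ ℓ : PBond (F.P K) 0, dist1 (U ℓ * ((GaugeField.gaugeAct w U₀) ℓ)⁻¹) ≤ δ) →
      (⨅ w : {w : Site (F.P K) 0 → Matrix.specialUnitaryGroup (Fin 2) ℂ |
          ∀ U : GaugeField (F.P K) 0 (Matrix.specialUnitaryGroup (Fin 2) ℂ),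
            descendTo F ℰp J K hJK (GaugeField.gaugeAct w U) = descendTo F ℰp J K hJK U},
        ∑ ℓ : PBond (F.P K) 0,
          dist1 (U ℓ * ((GaugeField.gaugeAct (w : Site (F.P K) 0 → Matrix.specialUnitaryGroup (Fin 2) ℂ) U₀) ℓ)⁻¹) ^ 2) ≤ r →
      c * (⨅ w : {w : Site (F.P K) 0 → Matrix.specialUnitaryGroup (Fin 2) ℂ |
          ∀ U : GaugeField (F.P K) 0 (Matrix.specialUnitaryGroup (Fin 2) ℂ),
            descendTo F ℰp J K hJK (GaugeField.gaugeAct w U) = descendTo F ℰp J K hJK U},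
        ∑ ℓ : PBond (F.P K) 0,
          dist1 (U ℓ * ((GaugeField.gaugeAct (w : Site (F.P K) 0 → Matrix.specialUnitaryGroup (Fin 2) ℂ) U₀) ℓ)⁻¹) ^ 2)
        ≤ wilsonAction4 U - minActionRegPr F J K hJK ε₀ V) := by
  rw [minActionRegPr_gaugeAct F hJK hε₀]
  constructor
  · intro h U hU htube hr
    have hU' := (mem_closure_goodFibre_gaugeAct_iff F hJK u (γ := γ) (b₀ := b₀) (p₀ := p₀) V U).2 hU
    have h1 := h (GaugeField.gaugeAct u U) hU' ((tube_gaugeAct_iff F hJK u U U₀ δ).2 htube)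
    rw [iInf_orbitDistSq_gaugeAct, wilsonAction4_gaugeAct] at h1
    exact h1 hr
  · intro h U hU htube hr
    obtain ⟨W, rfl⟩ : ∃ W, U = GaugeField.gaugeAct u W := ⟨_, (gaugeAct_gaugeAct_inv F u U).symm⟩
    have hW := (mem_closure_goodFibre_gaugeAct_iff F hJK u (γ := γ) (b₀ := b₀) (p₀ := p₀) V W).1 hU
    have h1 := h W hW ((tube_gaugeAct_iff F hJK u W U₀ δ).1 htube)
    rw [iInf_orbitDistSq_gaugeAct] at hr
    rw [iInf_orbitDistSq_gaugeAct, wilsonAction4_gaugeAct]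
    exact h1 hr

/-- ★ **ISOL∘(δ) IS EQUIVARIANT** (the `hisol` binder of (T3) ∕ ✓`tubeGrowth_of_pos_of_isolated`). [cite: Balaban1985Variational, Prop. 7 p.299, (4) p.278] -/
theorem isolAt_gaugeAct_iff (u : Site (F.P K) 0 → Matrix.specialUnitaryGroup (Fin 2) ℂ) {γ b₀ p₀ ε₀ : ℝ} (hε₀ : 0 ≤ ε₀)
    (V : GaugeField (F.P J) 0 (Matrix.specialUnitaryGroup (Fin 2) ℂ)) (U₀ : GaugeField (F.P K) 0 (Matrix.specialUnitaryGroup (Fin 2) ℂ))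
    (δ : ℝ) :
    (∀ U ∈ closure (fibre F ℰp J K hJK (GaugeField.gaugeAct (descTransf F J K hJK u) V) ∩ histGood F ℰp (θBal F.L γ b₀ p₀) K J),
      (∃ w : Site (F.P K) 0 → Matrix.specialUnitaryGroup (Fin 2) ℂ,
        (∀ U'' : GaugeField (F.P K) 0 (Matrix.specialUnitaryGroup (Fin 2) ℂ),
            descendTo F ℰp J K hJK (GaugeField.gaugeAct w U'') = descendTo F ℰp J K hJK U'') ∧
          ∀ ℓ : PBond (F.P K) 0, dist1 (U ℓ * ((GaugeField.gaugeAct w (GaugeField.gaugeAct u U₀)) ℓ)⁻¹) ≤ δ) →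
      wilsonAction4 U ≤ minActionRegPr F J K hJK ε₀ (GaugeField.gaugeAct (descTransf F J K hJK u) V) →
      (⨅ w : {w : Site (F.P K) 0 → Matrix.specialUnitaryGroup (Fin 2) ℂ |
          ∀ U : GaugeField (F.P K) 0 (Matrix.specialUnitaryGroup (Fin 2) ℂ),
            descendTo F ℰp J K hJK (GaugeField.gaugeAct w U) = descendTo F ℰp J K hJK U},
        ∑ ℓ : PBond (F.P K) 0,
          dist1 (U ℓ * ((GaugeField.gaugeAct (w : Site (F.P K) 0 → Matrix.specialUnitaryGroup (Fin 2) ℂ) (GaugeField.gaugeAct u U₀)) ℓ)⁻¹) ^ 2) = 0) ↔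
    (∀ U ∈ closure (fibre F ℰp J K hJK V ∩ histGood F ℰp (θBal F.L γ b₀ p₀) K J),
      (∃ w : Site (F.P K) 0 → Matrix.specialUnitaryGroup (Fin 2) ℂ,
        (∀ U'' : GaugeField (F.P K) 0 (Matrix.specialUnitaryGroup (Fin 2) ℂ),
            descendTo F ℰp J K hJK (GaugeField.gaugeAct w U'') = descendTo F ℰp J K hJK U'') ∧
          ∀ ℓ : PBond (F.P K) 0, dist1 (U ℓ * ((GaugeField.gaugeAct w U₀) ℓ)⁻¹) ≤ δ) →
      wilsonAction4 U ≤ minActionRegPr F J K hJK ε₀ V →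
      (⨅ w : {w : Site (F.P K) 0 → Matrix.specialUnitaryGroup (Fin 2) ℂ |
          ∀ U : GaugeField (F.P K) 0 (Matrix.specialUnitaryGroup (Fin 2) ℂ),
            descendTo F ℰp J K hJK (GaugeField.gaugeAct w U) = descendTo F ℰp J K hJK U},
        ∑ ℓ : PBond (F.P K) 0,
          dist1 (U ℓ * ((GaugeField.gaugeAct (w : Site (F.P K) 0 → Matrix.specialUnitaryGroup (Fin 2) ℂ) U₀) ℓ)⁻¹) ^ 2) = 0) := by
  rw [minActionRegPr_gaugeAct F hJK hε₀]
  constructor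
  · intro h U hU htube hA
    have hU' := (mem_closure_goodFibre_gaugeAct_iff F hJK u (γ := γ) (b₀ := b₀) (p₀ := p₀) V U).2 hU
    have h1 := h (GaugeField.gaugeAct u U) hU' ((tube_gaugeAct_iff F hJK u U U₀ δ).2 htube)
    rw [iInf_orbitDistSq_gaugeAct, wilsonAction4_gaugeAct] at h1
    exact h1 hA
  · intro h U hU htube hA
    obtain ⟨W, rfl⟩ : ∃ W, U = GaugeField.gaugeAct u W := ⟨_, (gaugeAct_gaugeAct_inv F u U).symm⟩
    have hW := (mem_closure_goodFibre_gaugeAct_iff F hJK u (γ := γ) (b₀ := b₀) (p₀ := p₀) V W).1 hU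
    have h1 := h W hW ((tube_gaugeAct_iff F hJK u W U₀ δ).1 htube)
    rw [wilsonAction4_gaugeAct] at hA
    rw [iInf_orbitDistSq_gaugeAct]
    exact h1 hA

/-! ## §2 The orbit-level flat inhabitant: TUBE♭ ∕ GAP♭ at every pure-gauge datum -/

/-- `(liftTransfTo v)↓ • 1 = v • 1`: the pure-gauge datum `v•1` is the coarse image of the fine pure gauge `v̂•1`. [cite: Balaban1985Averaging, (12) p.19] -/
theorem gaugeAct_descTransf_liftTransfTo_one (v : Site (F.P J) 0 → Matrix.specialUnitaryGroup (Fin 2) ℂ) :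
    GaugeField.gaugeAct (descTransf F J K hJK (liftTransfTo F J K hJK v)) (1 : GaugeField (F.P J) 0 (Matrix.specialUnitaryGroup (Fin 2) ℂ)) =
      GaugeField.gaugeAct v 1 := by
  rw [descTransf_liftTransfTo]

/-- ★★ **GAP♭ AT EVERY PURE-GAUGE DATUM `(V, U₀) = (v•1, v̂•1)` ⟸ ISOL∘(δ) THERE** (`v̂ := liftTransfTo v`; `γ ≤ γ₁(L, b₀, p₀, δ)` — the SAME
`γ₁` as ✓brick 5 §1 `exists_gapFlat_flat_of_isolated`): transport the flat-datum theorem along the orbit (§3), transporting the ISOL∘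
hypothesis back (§3). [cite: Balaban1985Variational, (142) p.299, Prop. 7 p.299, p.278 and Sect. G p.305; Balaban1985UV3, (12)-(13) p.259, (18)-(22) p.260] -/
theorem exists_gapFlat_pureGauge_of_isolated (L : ℕ) (b₀ p₀ : ℝ) (hb : 0 < b₀) (hp : 0 < p₀) (δ : ℝ) (hδ : 0 < δ) :
    ∃ γ₁ : ℝ, 0 < γ₁ ∧ ∀ (F : T3Family) (γ : ℝ), F.L = L → 0 < γ → γ ≤ γ₁ →
      ∀ (J K : ℕ) (hJK : J ≤ K) (hk : K - J ≤ (F.P K).m + (F.P K).K)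
        (ε₀ : ℝ), 0 < ε₀ → (143 * ((((3 + 4 : ℕ) : ℝ)) ^ 2 / 4) ^ 2) * (2 * ε₀) ≤ 1 / 3 →
          2 * (2 * ε₀) ≤ 2 * deltaSU (Fin 2) / (((3 + 4) * F.L : ℕ) : ℝ) ^ 2 →
        ∀ v : Site (F.P J) 0 → Matrix.specialUnitaryGroup (Fin 2) ℂ,
        (∀ U ∈ closure (fibre F ℰp J K hJK (GaugeField.gaugeAct v (1 : GaugeField (F.P J) 0 (Matrix.specialUnitaryGroup (Fin 2) ℂ))) ∩
            histGood F ℰp (θBal F.L γ b₀ p₀) K J),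
          (∃ w : Site (F.P K) 0 → Matrix.specialUnitaryGroup (Fin 2) ℂ,
            (∀ U'' : GaugeField (F.P K) 0 (Matrix.specialUnitaryGroup (Fin 2) ℂ),
                descendTo F ℰp J K hJK (GaugeField.gaugeAct w U'') = descendTo F ℰp J K hJK U'') ∧
              ∀ ℓ : PBond (F.P K) 0, dist1 (U ℓ * ((GaugeField.gaugeAct w
                (GaugeField.gaugeAct (liftTransfTo F J K hJK v) (1 : GaugeField (F.P K) 0 (Matrix.specialUnitaryGroup (Fin 2) ℂ)))) ℓ)⁻¹) ≤ δ) →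
          wilsonAction4 U ≤ minActionRegPr F J K hJK ε₀ (GaugeField.gaugeAct v (1 : GaugeField (F.P J) 0 (Matrix.specialUnitaryGroup (Fin 2) ℂ))) →
          (⨅ w : {w : Site (F.P K) 0 → Matrix.specialUnitaryGroup (Fin 2) ℂ |
              ∀ U : GaugeField (F.P K) 0 (Matrix.specialUnitaryGroup (Fin 2) ℂ),
                descendTo F ℰp J K hJK (GaugeField.gaugeAct w U) = descendTo F ℰp J K hJK U},
            ∑ ℓ : PBond (F.P K) 0,
              dist1 (U ℓ * ((GaugeField.gaugeAct (w : Site (F.P K) 0 → Matrix.specialUnitaryGroup (Fin 2) ℂ)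
                (GaugeField.gaugeAct (liftTransfTo F J K hJK v) (1 : GaugeField (F.P K) 0 (Matrix.specialUnitaryGroup (Fin 2) ℂ)))) ℓ)⁻¹) ^ 2) = 0) →
        ∃ μ : ℝ, 0 < μ ∧ ∀ U ∈ fibre F ℰp J K hJK (GaugeField.gaugeAct v (1 : GaugeField (F.P J) 0 (Matrix.specialUnitaryGroup (Fin 2) ℂ))),
          U ∈ histGood F ℰp (θBal F.L γ b₀ p₀) K J →
        μ * ((F.L : ℝ)⁻¹) ^ (2 * (K - J)) *
        (⨅ w : {w : Site (F.P K) 0 → Matrix.specialUnitaryGroup (Fin 2) ℂ |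
        ∀ U : GaugeField (F.P K) 0 (Matrix.specialUnitaryGroup (Fin 2) ℂ),
        descendTo F ℰp J K hJK (GaugeField.gaugeAct w U) = descendTo F ℰp J K hJK U},
        ∑ ℓ : PBond (F.P K) 0,
        dist1 (U ℓ * ((GaugeField.gaugeAct (w : Site (F.P K) 0 → Matrix.specialUnitaryGroup (Fin 2) ℂ)
          (GaugeField.gaugeAct (liftTransfTo F J K hJK v) (1 : GaugeField (F.P K) 0 (Matrix.specialUnitaryGroup (Fin 2) ℂ)))) ℓ)⁻¹) ^ 2)
        ≤ wilsonAction4 U - minActionRegPr F J K hJK ε₀ (GaugeField.gaugeAct v (1 : GaugeField (F.P J) 0 (Matrix.specialUnitaryGroup (Fin 2) ℂ))) := by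
  obtain ⟨γ₁, hγ₁, hmain⟩ := exists_gapFlat_flat_of_isolated L b₀ p₀ hb hp δ hδ
  refine ⟨γ₁, hγ₁, ?_⟩
  intro F γ hFL hγ hγle J K hJK hk ε₀ hε₀ hr3 hr2 v hisol
  -- transport ISOL∘ back to the flat datum, apply brick 5 §1 there, transport GAP♭ forward
  have hv := gaugeAct_descTransf_liftTransfTo_one F hJK v
  rw [← hv] at hisol ⊢
  have hisol1 := (isolAt_gaugeAct_iff F hJK (liftTransfTo F J K hJK v) (γ := γ) (b₀ := b₀) (p₀ := p₀) hε₀.le 1 1 δ).1 hisol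
  obtain ⟨μ, hμ, hgap⟩ := hmain F γ hFL hγ hγle J K hJK hk ε₀ hε₀ hr3 hr2 hisol1
  exact ⟨μ, hμ, (gapFlatAt_gaugeAct_iff F hJK (liftTransfTo F J K hJK v) (γ := γ) (b₀ := b₀) (p₀ := p₀) hε₀.le 1 1 μ).2 hgap⟩


/-- ★★★ **TUBE♭ OUTRIGHT AT EVERY PURE-GAUGE DATUM `(V, U₀) = (v•1, v̂•1)`** (`v̂ := liftTransfTo v`; every `δ`; the SAME `γ₁` and, per
`(F, γ, J, K, ε₀, δ)`, the SAME `μ` as ✓px12 `exists_tubeGrowth_flat` at `(1,1)`): transport along the orbit (`tubeGrowthAt_gaugeAct_iff`).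
NO Prop-7 letter, NO CL, NO HESS∘, NO ISOL∘. [cite: Balaban1985Variational, (142) p.299, Prop. 7 p.299, p.278 and Sect. G p.305; Balaban1985UV3, (12)-(13) p.259, (18)-(22) p.260] -/
theorem exists_tubeGrowth_pureGauge (L : ℕ) (b₀ p₀ : ℝ) (hb : 0 < b₀) (hp : 0 < p₀) :
    ∃ γ₁ : ℝ, 0 < γ₁ ∧ ∀ (F : T3Family) (γ : ℝ), F.L = L → 0 < γ → γ ≤ γ₁ →
      ∀ (J K : ℕ) (hlt : J < K) (hk : K - J ≤ (F.P K).m + (F.P K).K)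
        (ε₀ : ℝ), 0 < ε₀ → (143 * ((((3 + 4 : ℕ) : ℝ)) ^ 2 / 4) ^ 2) * (2 * ε₀) ≤ 1 / 3 →
          2 * (2 * ε₀) ≤ 2 * deltaSU (Fin 2) / (((3 + 4) * F.L : ℕ) : ℝ) ^ 2 →
        ∀ (v : Site (F.P J) 0 → Matrix.specialUnitaryGroup (Fin 2) ℂ) (δ : ℝ),
          ∃ μ : ℝ, 0 < μ ∧ ∀ U ∈ fibre F ℰp J K hlt.le (GaugeField.gaugeAct v (1 : GaugeField (F.P J) 0 (Matrix.specialUnitaryGroup (Fin 2) ℂ))),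
            U ∈ histGood F ℰp (θBal F.L γ b₀ p₀) K J →
          (∃ w : Site (F.P K) 0 → Matrix.specialUnitaryGroup (Fin 2) ℂ,
          (∀ U'' : GaugeField (F.P K) 0 (Matrix.specialUnitaryGroup (Fin 2) ℂ),
          descendTo F ℰp J K hlt.le (GaugeField.gaugeAct w U'') = descendTo F ℰp J K hlt.le U'') ∧
          ∀ ℓ : PBond (F.P K) 0, dist1 (U ℓ * ((GaugeField.gaugeAct w
            (GaugeField.gaugeAct (liftTransfTo F J K hlt.le v) (1 : GaugeField (F.P K) 0 (Matrix.specialUnitaryGroup (Fin 2) ℂ)))) ℓ)⁻¹) ≤ δ) →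
          μ * ((F.L : ℝ)⁻¹) ^ (2 * (K - J)) *
          (⨅ w : {w : Site (F.P K) 0 → Matrix.specialUnitaryGroup (Fin 2) ℂ |
          ∀ U : GaugeField (F.P K) 0 (Matrix.specialUnitaryGroup (Fin 2) ℂ),
          descendTo F ℰp J K hlt.le (GaugeField.gaugeAct w U) = descendTo F ℰp J K hlt.le U},
          ∑ ℓ : PBond (F.P K) 0,
          dist1 (U ℓ * ((GaugeField.gaugeAct (w : Site (F.P K) 0 → Matrix.specialUnitaryGroup (Fin 2) ℂ)
            (GaugeField.gaugeAct (liftTransfTo F J K hlt.le v) (1 : GaugeField (F.P K) 0 (Matrix.specialUnitaryGroup (Fin 2) ℂ)))) ℓ)⁻¹) ^ 2)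
          ≤ wilsonAction4 U - minActionRegPr F J K hlt.le ε₀ (GaugeField.gaugeAct v (1 : GaugeField (F.P J) 0 (Matrix.specialUnitaryGroup (Fin 2) ℂ))) := by
  obtain ⟨γ₁, hγ₁, hmain⟩ := exists_tubeGrowth_flat L b₀ p₀ hb hp
  refine ⟨γ₁, hγ₁, ?_⟩
  intro F γ hFL hγ hγle J K hlt hk ε₀ hε₀ hr3 hr2 v δ
  obtain ⟨μ, hμ, htube⟩ := hmain F γ hFL hγ hγle J K hlt hk ε₀ hε₀ hr3 hr2 δ
  refine ⟨μ, hμ, ?_⟩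
  rw [← gaugeAct_descTransf_liftTransfTo_one F hlt.le v]
  exact (tubeGrowthAt_gaugeAct_iff F hlt.le (liftTransfTo F J K hlt.le v) (γ := γ) (b₀ := b₀) (p₀ := p₀) hε₀.le 1 1 δ μ).2 htube

/-- ★★★ **GAP♭ OUTRIGHT AT EVERY PURE-GAUGE DATUM `(V, U₀) = (v•1, v̂•1)`** (`γ ≤ γ₁(L, b₀, p₀, δ)` — the SAME `γ₁` as ✓px12 `exists_gapFlat_flat`,
and per `(F, γ, J, K, ε₀)` the SAME `μ`): transport along the orbit (`gapFlatAt_gaugeAct_iff`).  NO letter.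
[cite: Balaban1985Variational, (142) p.299, Prop. 7 p.299, p.278 and Sect. G p.305; Balaban1984PropagatorsII, (1.33); Balaban1985UV3, (12)-(13) p.259] -/
theorem exists_gapFlat_pureGauge (L : ℕ) (b₀ p₀ : ℝ) (hb : 0 < b₀) (hp : 0 < p₀) (δ : ℝ) (hδ : 0 < δ) :
    ∃ γ₁ : ℝ, 0 < γ₁ ∧ ∀ (F : T3Family) (γ : ℝ), F.L = L → 0 < γ → γ ≤ γ₁ →
      ∀ (J K : ℕ) (hlt : J < K) (hk : K - J ≤ (F.P K).m + (F.P K).K)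
        (ε₀ : ℝ), 0 < ε₀ → (143 * ((((3 + 4 : ℕ) : ℝ)) ^ 2 / 4) ^ 2) * (2 * ε₀) ≤ 1 / 3 →
          2 * (2 * ε₀) ≤ 2 * deltaSU (Fin 2) / (((3 + 4) * F.L : ℕ) : ℝ) ^ 2 →
        ∀ v : Site (F.P J) 0 → Matrix.specialUnitaryGroup (Fin 2) ℂ,
        ∃ μ : ℝ, 0 < μ ∧ ∀ U ∈ fibre F ℰp J K hlt.le (GaugeField.gaugeAct v (1 : GaugeField (F.P J) 0 (Matrix.specialUnitaryGroup (Fin 2) ℂ))),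
          U ∈ histGood F ℰp (θBal F.L γ b₀ p₀) K J →
        μ * ((F.L : ℝ)⁻¹) ^ (2 * (K - J)) *
        (⨅ w : {w : Site (F.P K) 0 → Matrix.specialUnitaryGroup (Fin 2) ℂ |
        ∀ U : GaugeField (F.P K) 0 (Matrix.specialUnitaryGroup (Fin 2) ℂ),
        descendTo F ℰp J K hlt.le (GaugeField.gaugeAct w U) = descendTo F ℰp J K hlt.le U},
        ∑ ℓ : PBond (F.P K) 0,
        dist1 (U ℓ * ((GaugeField.gaugeAct (w : Site (F.P K) 0 → Matrix.specialUnitaryGroup (Fin 2) ℂ)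
          (GaugeField.gaugeAct (liftTransfTo F J K hlt.le v) (1 : GaugeField (F.P K) 0 (Matrix.specialUnitaryGroup (Fin 2) ℂ)))) ℓ)⁻¹) ^ 2)
        ≤ wilsonAction4 U - minActionRegPr F J K hlt.le ε₀ (GaugeField.gaugeAct v (1 : GaugeField (F.P J) 0 (Matrix.specialUnitaryGroup (Fin 2) ℂ))) := by
  obtain ⟨γ₁, hγ₁, hmain⟩ := exists_gapFlat_flat L b₀ p₀ hb hp δ hδ
  refine ⟨γ₁, hγ₁, ?_⟩
  intro F γ hFL hγ hγle J K hlt hk ε₀ hε₀ hr3 hr2 v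
  obtain ⟨μ, hμ, hgap⟩ := hmain F γ hFL hγ hγle J K hlt hk ε₀ hε₀ hr3 hr2
  refine ⟨μ, hμ, ?_⟩
  rw [← gaugeAct_descTransf_liftTransfTo_one F hlt.le v]
  exact (gapFlatAt_gaugeAct_iff F hlt.le (liftTransfTo F J K hlt.le v) (γ := γ) (b₀ := b₀) (p₀ := p₀) hε₀.le 1 1 μ).2 hgap

end Summit.QuantumFields.YangMills.Theorems.FluctuationComparisonRegPrIntLS2BetaTubeLettersOrbitTransportOutright

end
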